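import Literature.Geometry.Lorentzian.CoordConstraintAdjoint
import HarnessLib

/-!
# The Killing initial data (KID) equations from the kernel of the adjoint `DΦ*`

In the coordinate tensor calculus (`MetricCoord`: metric components `G` on an open set `V` of a
finite-dimensional space, `IsMetricOn G V`, any signature) `CoordConstraintAdjoint.lean` vendors the
formal adjoint of the linearised constraint map at data `(G, K)` as the four rows
`DH*_γ N = adjHamG`, `DH*_κ N = adjHamK`, `DM*ˢ_γ X = adjMomGS`, `DM*ˢ_κ X = adjMomKS` (Chruściel–Delay
2003, §2; Moncrief 1975), so that a **KID** `(N, X)` is a solution of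
`adjHamG G K N + adjMomGS G K X = 0` and `adjHamK G K N + adjMomKS G X = 0`. This file extracts from
these two tensor equations, pointwise, the classical form of the Killing initial data equations —
the statement that the data are stationary under the evolution with lapse `2N` and shift `X`
(Moncrief 1975, §IV; Beig–Chruściel 1997, (1.3)–(1.4); in the normalisation of the tree the lapse
of the space–time vector generated by `(N, X)` is `2N`):

* `IsMetricOn.divAt_eq_of_kidK` — the `κ`-row traced: `div X = −2N tr_G K` (dimension `≠ 1`);
* `IsMetricOn.symAt_covDAt_eq_of_kidK`, **`IsMetricOn.lieFormAt_metric_eq_of_kidK`** — the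
  `κ`-row itself then reads `sym G(∇X·,·) = −2N K`, i.e. **`𝓛_X G = −4N K`** (the first KID equation
  `𝓛_X g + 2αK = 0`, `α = 2N`);
* `IsMetricOn.mtrAt_lieFormAt_eq`, `IsMetricOn.divAt_sharp_contract_eq` — the traces
  `tr_G 𝓛_X K = ∂_X tr_G K + ⟨𝓛_X G, K⟩` and `div((K(X,·))^♯) = (div_G K)(X) + ⟨K, G(∇X·,·)⟩`;
* **`IsMetricOn.kid₂_eq_zero`** — given both rows, the vacuum constraints `H = 0`, `M(X) = 0` at the
  point and dimension `≠ 1`, **the second KID equation**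
  `Hess N − N Ric − N (tr K) K + 2N K∘♯K + ½ 𝓛_X K = 0`
  (`α = 2N`: `𝓛_X K + Hess α − α(Ric + tr K · K − 2 K∘♯K) = 0`). Proof: by the definitions the
  `γ`-row is this tensor minus `(ΔN + ½ div((K(X,·))^♯)) G`; its `G`-trace equals the coefficient
  itself once `H = 0`, `M(X) = 0` and the first KID equation are used, so `(dim − 1)` times the
  coefficient vanishes.

These are the Cauchy data, on the initial hypersurface, of the Killing equation for the space–time
vector field `2N ν + X` (Moncrief 1975: KIDs are exactly the normal–tangential splittings of Killing
fields of the vacuum development). Everything is proved; no definition and no statement of `Prop`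
type is introduced.

## References

* V. Moncrief, *Spacetime symmetries and linearization stability of the Einstein equations. I*,
  J. Math. Phys. 16 (1975) 493–498, §§III–IV. [Moncrief1975]
* P. T. Chruściel, E. Delay, Mém. Soc. Math. Fr. 94 (2003), §2 (the operator `P*`). [ChruscielDelay2003]
* A. E. Fischer, J. E. Marsden, V. Moncrief, Ann. Inst. H. Poincaré A 33 (1980) 147–194, §1,
  (1.9), and Lemma 2.2. [FischerMarsdenMoncrief1980]
-/

noncomputable section

open Set Filter ContinuousLinearMap Module
open scoped Topology ContDiff

namespace Literature.Geometry.Lorentzian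

namespace MetricCoord

variable {E : Type*} [NormedAddCommGroup E] [NormedSpace ℝ E]

section KID

variable {ι : Type*} [Fintype ι] [FiniteDimensional ℝ E] [CompleteSpace E] (b : Basis ι ℝ E)
  {G K : E → E →L[ℝ] E →L[ℝ] ℝ} {V : Set E} {x : E} {N : E → ℝ} {X : E → E}

/-! ### Traces -/

omit [Fintype ι] [CompleteSpace E] in
/-- `tr_G G = dim E`. [cite: ONeill1983, Ch. 3, pp. 60–61] -/
theorem mtrAt_metric (hi : (G x).IsInvertible) (hs : ∀ v w : E, G x v w = G x w v) :
    mtrAt G x (G x) = finrank ℝ E := by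
  rw [← pairAt_metric_right hi, pairAt_self_of_symm G x hs, normSqAt_metric hi hs]

omit [Fintype ι] [CompleteSpace E] in
/-- `tr_G (K∘♯K) = ⟨K, K⟩_G = |K|²_G` for a symmetric `K`. [cite: ONeill1983, Ch. 3, pp. 60–61] -/
theorem mtrAt_comp_sharp_comp (hi : (G x).IsInvertible) {Kx : E →L[ℝ] E →L[ℝ] ℝ}
    (hKs : ∀ v w, Kx v w = Kx w v) :
    mtrAt G x (Kx.comp ((sharpAt G x).comp Kx)) = normSqAt G x Kx := by
  rw [mtrAt_comp_eq_pairAt hi, ← pairAt_self_of_symm G x hKs]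
  congr 1
  ext v w
  simp only [ContinuousLinearMap.comp_apply, apply_sharpAt_apply hi]

omit [Fintype ι] [CompleteSpace E] in
/-- `tr_G (sym B) = tr_G B`. [folklore] -/
theorem mtrAt_symAt (hi : (G x).IsInvertible) (hs : ∀ v w : E, G x v w = G x w v)
    (B : E →L[ℝ] E →L[ℝ] ℝ) : mtrAt G x (symAt B) = mtrAt G x B := by
  rw [symAt, mtrAt_smul, mtrAt_add, mtrAt_flip hi hs]
  ring

omit [Fintype ι] [CompleteSpace E] in
/-- `tr_G (G(A·,·)) = tr A`; in particular `tr_G (G(∇X·,·)) = div X`. [cite: ONeill1983, Ch. 3, p. 86] -/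
theorem mtrAt_metric_comp_covDAt (hi : (G x).IsInvertible) (X : E → E) :
    mtrAt G x ((G x).comp (covDAt G X x)) = divAt G X x := by
  rw [mtrAt_metric_comp hi, divAt_eq]

/-! ### The `κ`-row: `div X = −2N tr K` and `𝓛_X G = −4N K` -/

omit [Fintype ι] [CompleteSpace E] in
/-- **The traced `κ`-row**: if `DH*_κ N + DM*ˢ_κ X = 0` at `x` then `div X = −2N tr_G K`
(dimension `≠ 1`). [cite: Moncrief1975, §IV] -/
theorem IsMetricOn.divAt_eq_of_kidK (hG : IsMetricOn G V) (hx : x ∈ V) (hn : finrank ℝ E ≠ 1)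
    (hκ : adjHamK G K N x + adjMomKS G X x = 0) :
    divAt G X x = -(2 * N x * mtrAt G x (K x)) := by
  have hi := hG.isInvertible x hx
  have hs := hG.symm x hx
  have htr := congrArg (mtrAt G x) hκ
  have h0 : mtrAt G x 0 = 0 := by simp [mtrAt]
  simp only [h0, adjHamK, adjMomKS, mtrAt_add, mtrAt_neg, mtrAt_smul, mtrAt_symAt hi hs,
    mtrAt_metric_comp_covDAt hi, mtrAt_metric hi hs] at htr
  -- `(n − 1) (div X + 2N trK) = 0`
  have hn1 : ((finrank ℝ E : ℝ) - 1) ≠ 0 := by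
    have : (finrank ℝ E : ℝ) ≠ 1 := by exact_mod_cast hn
    exact sub_ne_zero.mpr this
  have hkey : ((finrank ℝ E : ℝ) - 1) * (divAt G X x + 2 * N x * mtrAt G x (K x)) = 0 := by
    linear_combination htr
  have := (mul_eq_zero.mp hkey).resolve_left hn1
  linarith

omit [Fintype ι] [CompleteSpace E] in
/-- **The `κ`-row as the first KID equation, symmetrised form**: `sym G(∇X·,·) = −2N K` at `x`.
[cite: Moncrief1975, §IV] -/
theorem IsMetricOn.symAt_covDAt_eq_of_kidK (hG : IsMetricOn G V) (hx : x ∈ V) (hn : finrank ℝ E ≠ 1)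
    (hκ : adjHamK G K N x + adjMomKS G X x = 0) :
    symAt ((G x).comp (covDAt G X x)) = -(2 * N x) • K x := by
  have hdiv := hG.divAt_eq_of_kidK hx hn hκ
  have h : adjHamK G K N x + adjMomKS G X x = 0 := hκ
  rw [adjHamK, adjMomKS, hdiv] at h
  -- `−2N K + 2N trK G − sym + (−2N trK) G = 0`, evaluated on `(v, w)`
  ext v w
  have hvw := congrArg (fun B : E →L[ℝ] E →L[ℝ] ℝ ↦ B v w) h
  simp only [_root_.add_apply, _root_.smul_apply, _root_.neg_apply, smul_eq_mul, _root_.zero_apply] at hvw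
  simp only [_root_.smul_apply, smul_eq_mul]
  linarith

omit [Fintype ι] [CompleteSpace E] in
/-- **The first KID equation** `𝓛_X G = −4N K` at `x` (the `κ`-row of the adjoint: Moncrief 1975,
§IV; Beig–Chruściel 1997, (1.3) with lapse `2N`). [cite: Moncrief1975, §IV] -/
theorem IsMetricOn.lieFormAt_metric_eq_of_kidK (hG : IsMetricOn G V) (hx : x ∈ V) (hn : finrank ℝ E ≠ 1)
    (hκ : adjHamK G K N x + adjMomKS G X x = 0) :
    lieFormAt G X x = -(4 * N x) • K x := by
  rw [hG.lieFormAt_metric_eq_symAt hx X, hG.symAt_covDAt_eq_of_kidK hx hn hκ, smul_smul]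
  congr 1
  ring

/-! ### Traces of `𝓛_X K` and of `div((K(X,·))^♯)` -/

omit [Fintype ι] in
/-- `tr_G (𝓛_X K) = ∂_X (tr_G K) + 2 ⟨K, G(∇X·,·)⟩_G` (the metric trace commutes with `∇_X`, and
`tr_G K(∇X·,·) = ⟨K, G(∇X·,·)⟩`); with the first KID equation the pairing is `⟨K, −2N K⟩`.
[cite: ONeill1983, Ch. 3, p. 86] -/
theorem IsMetricOn.mtrAt_lieFormAt_eq (hG : IsMetricOn G V) (hx : x ∈ V) (hKd : DifferentiableAt ℝ K x)
    (hKs : ∀ v w, K x v w = K x w v) (X : E → E) :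
    mtrAt G x (lieFormAt K X x) =
      fderiv ℝ (fun y ↦ mtrAt G y (K y)) x (X x) + 2 * pairAt G x (K x) ((G x).comp (covDAt G X x)) := by
  have hi := hG.isInvertible x hx
  have hs := hG.symm x hx
  have hL : lieFormAt K X x = cov₂At G K x (X x) + (K x).comp (covDAt G X x)
      + ((K x).comp (covDAt G X x)).flip := by
    ext v w
    rw [lieFormAt_eq_cov G K X x v w]
    simp only [_root_.add_apply, ContinuousLinearMap.comp_apply, flip_apply]
    rw [hKs v (covDAt G X x w)]
  rw [hL, mtrAt_add, mtrAt_add, mtrAt_flip hi hs, hG.fderiv_mtrAt hx hKd, mtrAt_comp_eq_pairAt hi]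
  ring

omit [Fintype ι] [FiniteDimensional ℝ E] [CompleteSpace E] in
/-- The covariant derivative of a field of symmetric forms is symmetric in its form slots. [folklore] -/
theorem cov₂At_symm_of_symm (hV : IsOpen V) (hx : x ∈ V) (hKd : DifferentiableAt ℝ K x)
    (hKs : ∀ y ∈ V, ∀ v w, K y v w = K y w v) (u v w : E) :
    cov₂At G K x u v w = cov₂At G K x u w v := by
  have hev : (fun y ↦ K y v w) =ᶠ[𝓝 x] fun y ↦ K y w v :=
    Filter.eventually_of_mem (hV.mem_nhds hx) fun y hy ↦ hKs y hy v w
  have happ : ∀ v w, fderiv ℝ (fun y ↦ K y v w) x u = fderiv ℝ K x u v w := fun v w ↦ by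
    rw [((hKd.hasFDerivAt.clm_apply (hasFDerivAt_const v x)).clm_apply (hasFDerivAt_const w x)).fderiv]
    simp [ContinuousLinearMap.flip_apply]
  rw [cov₂At_apply, cov₂At_apply, ← happ v w, ← happ w v, hev.fderiv_eq, hKs x hx (chrAt G x u v) w,
    hKs x hx v (chrAt G x u w)]
  ring

omit [CompleteSpace E] in
/-- **`div((K(X,·))^♯) = (div_G K)(X) + ⟨K, G(∇X·,·)⟩_G`**, with `(div_G K)(X) = Σ g^{kl} (∇_{b_k} K)(b_l, X)`
the divergence entering the momentum constraint `M(X) = (div_G K)(X) − ∂_X tr_G K`.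
[cite: ONeill1983, Ch. 3, p. 86] -/
theorem IsMetricOn.divAt_sharp_contract_eq (hG : IsMetricOn G V) (hx : x ∈ V)
    (hKd : DifferentiableAt ℝ K x) (hKs : ∀ y ∈ V, ∀ v w, K y v w = K y w v)
    (hXd : DifferentiableAt ℝ X x) :
    divAt G (fun y ↦ sharpAt G y (K y (X y))) x =
      ∑ k, ∑ l, ginv G b x k l * cov₂At G K x (b k) (b l) (X x)
        + pairAt G x (K x) ((G x).comp (covDAt G X x)) := by
  have hi := hG.isInvertible x hx
  -- `G(∇_u (K(X,·))^♯, w) = (∇_u K)(X, w) + K(∇_u X, w)` as an identity of bilinear forms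
  have hform : (G x).comp (covDAt G (fun y ↦ sharpAt G y (K y (X y))) x) =
      (cov₂At G K x).flip (X x) + (K x).comp (covDAt G X x) := by
    ext u w
    simp only [ContinuousLinearMap.comp_apply, _root_.add_apply, flip_apply]
    exact hG.apply_covDAt_sharp_contract hx hKd hXd u w
  rw [divAt_eq, ← mtrAt_metric_comp hi, hform, mtrAt_add, mtrAt_comp_eq_pairAt hi, mtrAt_eq_sum b]
  congr 1
  refine Finset.sum_congr rfl fun k _ ↦ Finset.sum_congr rfl fun l _ ↦ ?_
  rw [flip_apply, cov₂At_symm_of_symm hG.isOpen hx hKd hKs]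

/-! ### The `γ`-row: the second KID equation -/

omit [CompleteSpace E] in
/-- **The second KID equation** (Moncrief 1975, §IV; Beig–Chruściel 1997, (1.4), lapse `α = 2N`):
if `(N, X)` annihilates both rows of `DΦ*` at `x`, the vacuum constraints `H = 0`, `M(X) = 0` hold
at `x`, `K` is symmetric near `x` and `dim E ≠ 1`, then
`Hess N − N Ric − N (tr_G K) K + 2N K∘♯K + ½ 𝓛_X K = 0` at `x`. [cite: Moncrief1975, §IV] -/
theorem IsMetricOn.kid₂_eq_zero (hG : IsMetricOn G V) (hx : x ∈ V) (hn : finrank ℝ E ≠ 1)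
    (hKd : DifferentiableAt ℝ K x) (hKs : ∀ y ∈ V, ∀ v w, K y v w = K y w v)
    (hXd : DifferentiableAt ℝ X x)
    (hκ : adjHamK G K N x + adjMomKS G X x = 0) (hγ : adjHamG G K N x + adjMomGS G K X x = 0)
    (hham : hamAt G K x = 0) (hmom : momFn b G K x (X x) = 0) :
    hessAt G N x - N x • ricAt G x - (N x * mtrAt G x (K x)) • K x
      + (2 * N x) • (K x).comp ((sharpAt G x).comp (K x)) + (2⁻¹ : ℝ) • lieFormAt K X x = 0 := by
  have hi := hG.isInvertible x hx
  have hs := hG.symm x hx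
  have hKsx : ∀ v w, K x v w = K x w v := hKs x hx
  have hdiv := hG.divAt_eq_of_kidK hx hn hκ
  have hsym := hG.symAt_covDAt_eq_of_kidK hx hn hκ
  -- the pairing `⟨K, G(∇X·,·)⟩ = ⟨K, sym G(∇X·,·)⟩ = −2N |K|²`
  have hpair : pairAt G x (K x) ((G x).comp (covDAt G X x)) = -(2 * N x) * normSqAt G x (K x) := by
    rw [← pairAt_symAt_right hi hs hKsx, hsym, pairAt_smul_right, pairAt_self_of_symm G x hKsx]
  -- `𝓛_X K = ∇_X K + 2 sym K(∇X·,·)`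
  have hL : lieFormAt K X x = cov₂At G K x (X x) + (2 : ℝ) • symAt ((K x).comp (covDAt G X x)) := by
    ext v w
    rw [lieFormAt_eq_cov G K X x v w]
    simp only [_root_.add_apply, _root_.smul_apply, symAt_apply, ContinuousLinearMap.comp_apply,
      smul_eq_mul]
    rw [hKsx v (covDAt G X x w)]
    ring
  -- abbreviations
  set Dz := hessAt G N x - N x • ricAt G x - (N x * mtrAt G x (K x)) • K x
      + (2 * N x) • (K x).comp ((sharpAt G x).comp (K x)) + (2⁻¹ : ℝ) • lieFormAt K X x with hDz
  set lam := lapAt G N x + 2⁻¹ * divAt G (fun y ↦ sharpAt G y (K y (X y))) x with hlam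
  -- the `γ`-row is `Dz − lam • G`
  have hrow : Dz - lam • G x = 0 := by
    rw [← hγ, hDz, hlam, adjHamG, adjMomGS, adjScalAt, hdiv, hL]
    ext v w
    simp only [_root_.sub_apply, _root_.add_apply, _root_.smul_apply, smul_eq_mul,
      ContinuousLinearMap.comp_apply]
    ring
  -- traces
  have htrDz : mtrAt G x Dz = lapAt G N x - N x * scalAt G x - N x * mtrAt G x (K x) ^ 2
      + 2 * N x * normSqAt G x (K x)
      + 2⁻¹ * (fderiv ℝ (fun y ↦ mtrAt G y (K y)) x (X x) - 4 * N x * normSqAt G x (K x)) := by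
    rw [hDz, mtrAt_add, mtrAt_add, mtrAt_sub, mtrAt_sub, mtrAt_smul, mtrAt_smul, mtrAt_smul, mtrAt_smul,
      mtrAt_comp_sharp_comp hi hKsx, hG.mtrAt_lieFormAt_eq hx hKd hKsx X, hpair, lapAt, scalAt]
    ring
  have hmom' : ∑ k, ∑ l, ginv G b x k l * cov₂At G K x (b k) (b l) (X x) =
      fderiv ℝ (fun y ↦ mtrAt G y (K y)) x (X x) := by
    have h := hmom
    rw [momFn_eq] at h
    linarith
  have hlam' : lam = lapAt G N x + 2⁻¹ * (fderiv ℝ (fun y ↦ mtrAt G y (K y)) x (X x)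
      - 2 * N x * normSqAt G x (K x)) := by
    rw [hlam, hG.divAt_sharp_contract_eq b hx hKd hKs hXd, hmom', hpair]
    ring
  have hham' : scalAt G x = normSqAt G x (K x) - mtrAt G x (K x) ^ 2 := by
    rw [hamAt_eq] at hham
    linarith
  -- `tr Dz = lam`, `tr (lam • G) = n lam`, so `(n − 1) lam = 0`
  have htr_eq : mtrAt G x Dz = lam := by
    rw [htrDz, hlam', hham']
    ring
  have htr0 : mtrAt G x Dz - lam * finrank ℝ E = 0 := by
    have := congrArg (mtrAt G x) hrow
    have h0 : mtrAt G x 0 = 0 := by simp [mtrAt]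
    rwa [h0, mtrAt_sub, mtrAt_smul, mtrAt_metric hi hs] at this
  have hn1 : ((finrank ℝ E : ℝ) - 1) ≠ 0 := by
    have : (finrank ℝ E : ℝ) ≠ 1 := by exact_mod_cast hn
    exact sub_ne_zero.mpr this
  have hlam0 : lam = 0 := by
    have hkey : ((finrank ℝ E : ℝ) - 1) * lam = 0 := by linear_combination -htr0 + htr_eq
    exact (mul_eq_zero.mp hkey).resolve_left hn1
  rw [hlam0] at hrow
  ext v w
  have hvw := congrArg (fun B : E →L[ℝ] E →L[ℝ] ℝ ↦ B v w) hrow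
  simp only [_root_.sub_apply, _root_.smul_apply, smul_eq_mul, zero_mul, sub_zero] at hvw
  simpa using hvw

end KID

end MetricCoord

end Literature.Geometry.Lorentzian

end
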